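import Mathlib

/-!
# T5FockInvariants — the Fock-model computations of (N4.3.P2-bis) and (N4.3.P2-ter)

Kernel form of the polynomial identities behind the irreducibility arguments of
route/T5-N4-p5.md (owner p5), sub-step N4.3 of Tier 5:

* (N4.3.P2-bis), `τ′_j` (`j = 2, 3`): the `U(3)`-invariants of the Fock space
  `ℂ[w_{i,1}, w_{i,2}]_{i ≤ 3}` are the polynomials in `Q := Σ_{i ≤ 3} w_{i,1} w_{i,2}`, and the
  lowering operator `D := Σ_{i ≤ 3} ∂²/∂w_{i,1}∂w_{i,2}` acts by
  `D(Q^k) = k(k + 2) Q^{k−1}` — non-zero for `k ≥ 1`, so every non-zero submodule of `ℂ[Q]`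
  contains `1 = Q⁰` (`D_Q_pow`, stated as `D(Q^{k+1}) = (k+1)(k+3) Q^k` for all `k`).
* (N4.3.P2-ter), the `β′`-isotypic part at `τ′_j`: `∂²/∂w₁∂w₂ (w₁^α w₂^β) = αβ w₁^{α−1} w₂^{β−1}`,
  non-zero unless `αβ = 0` (`pderiv_pderiv_monomial`, stated for `α + 1, β + 1`).
* (N4.3.P2-ter), the K-type matching: the two equations
  `(m′_A + 1)/2 + max(0, −c) = (m′ + 3)/2` and `(m′_A − 1)/2 − max(0, c) = (m′ − 3)/2`
  force `1 + |c| = 3`, i.e. `c = ±2` and `m′_A = m′ + c` — two solutions per place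
  (`ktype_match`).
* (N4.3.P2-ter), «the contragredient's K-types form a highest-weight ladder, never the K-type
  set of a lowest-weight module»: `{((m+3)/2 + k, (m−3)/2 − k) : k ∈ ℕ} ≠
  {(−(m+3)/2 − k, −(m−3)/2 + k) : k ∈ ℕ}` for every `m` (`lowest_ladder_ne_highest_ladder`).

Mathlib only (`MvPolynomial.pderiv`); the Lie-algebra action itself (`[KK07]` Prop. 4.4, the
form of the `𝔭^±`-operators — p5's G-N4.3.5) is NOT formalised: only the stated polynomial
identities are.
-/

namespace Summit.Ventures.HodgeRepro2.T5FockInvariants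

open MvPolynomial

/-- The Fock variables `w_{i,j}`: `i ∈ Fin 3` (the `U(3)`-index), `j ∈ Fin 2` (the column:
`j = 0 ↔ w_{i,1}`, `j = 1 ↔ w_{i,2}`). -/
abbrev Var := Fin 3 × Fin 2

/-- `Q = Σ_{i ≤ 3} w_{i,1} w_{i,2}`, the generator of the `U(3)`-invariants. -/
noncomputable def Q : MvPolynomial Var ℂ := ∑ i : Fin 3, X (i, 0) * X (i, 1)

/-- `D = Σ_{i ≤ 3} ∂²/∂w_{i,1}∂w_{i,2}`, the `U(3)`-invariant lowering operator. -/
noncomputable def D (p : MvPolynomial Var ℂ) : MvPolynomial Var ℂ :=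
  ∑ i : Fin 3, pderiv (i, 0) (pderiv (i, 1) p)

/-- `∂Q/∂w_{i,2} = w_{i,1}`. -/
theorem pderiv_Q_one (i : Fin 3) : pderiv (i, 1) Q = X (i, 0) := by
  unfold Q
  rw [map_sum]
  have h : ∀ j : Fin 3, pderiv (i, 1) (X (j, 0) * X (j, 1) : MvPolynomial Var ℂ)
      = if j = i then X (i, 0) else 0 := by
    intro j
    rw [Derivation.leibniz, pderiv_X, pderiv_X]
    by_cases hij : j = i
    · subst hij
      simp
    · have h1 : ((i, 1) : Var) ≠ (j, 1) := by
        intro h; exact hij (Prod.ext_iff.mp h).1.symm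
      have h2 : ((i, 1) : Var) ≠ (j, 0) := by
        intro h; have := congrArg Prod.snd h; simp at this
      simp [h1.symm, h2.symm, hij]
  simp_rw [h]
  simp

/-- `∂Q/∂w_{i,1} = w_{i,2}`. -/
theorem pderiv_Q_zero (i : Fin 3) : pderiv (i, 0) Q = X (i, 1) := by
  unfold Q
  rw [map_sum]
  have h : ∀ j : Fin 3, pderiv (i, 0) (X (j, 0) * X (j, 1) : MvPolynomial Var ℂ)
      = if j = i then X (i, 1) else 0 := by
    intro j
    rw [Derivation.leibniz, pderiv_X, pderiv_X]
    by_cases hij : j = i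
    · subst hij
      simp
    · have h1 : ((i, 0) : Var) ≠ (j, 0) := by
        intro h; exact hij (Prod.ext_iff.mp h).1.symm
      have h2 : ((i, 0) : Var) ≠ (j, 1) := by
        intro h; have := congrArg Prod.snd h; simp at this
      simp [h1.symm, h2.symm, hij]
  simp_rw [h]
  simp

/-- `∂(Q^{k+1})/∂w_{i,2} = (k+1) Q^k w_{i,1}`. -/
theorem pderiv_one_Q_pow (i : Fin 3) (k : ℕ) :
    pderiv (i, 1) (Q ^ (k + 1)) = ((k + 1 : ℕ) : MvPolynomial Var ℂ) * (Q ^ k * X (i, 0)) := by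
  rw [Derivation.leibniz_pow, pderiv_Q_one, Nat.add_sub_cancel, smul_eq_mul, nsmul_eq_mul]

/-- `∂(Q^k w_{i,1})/∂w_{i,1} = k Q^{k−1} w_{i,2} w_{i,1} + Q^k`. -/
theorem pderiv_zero_Q_pow_mul (i : Fin 3) (k : ℕ) :
    pderiv (i, 0) (Q ^ k * X (i, 0))
      = ((k : ℕ) : MvPolynomial Var ℂ) * (Q ^ (k - 1) * X (i, 1)) * X (i, 0) + Q ^ k := by
  rw [Derivation.leibniz, Derivation.leibniz_pow, pderiv_Q_zero, pderiv_X, Pi.single_eq_same,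
    smul_eq_mul, smul_eq_mul, smul_eq_mul, nsmul_eq_mul]
  ring

/-- **`D(Q^{k+1}) = (k+1)(k+3) Q^k`** — the lowering operator on the `U(3)`-invariants
(p5's `D(Q^k) = k(k+2)Q^{k−1}`, `k ≥ 1`): `D(Q^k) ≠ 0` for `k ≥ 1` over a field of
characteristic `0`, so every non-zero `D`-stable subspace of `ℂ[Q]` contains `1`. -/
theorem D_Q_pow (k : ℕ) :
    D (Q ^ (k + 1)) = (((k + 1) * (k + 3) : ℕ) : MvPolynomial Var ℂ) * Q ^ k := by
  unfold D
  simp_rw [pderiv_one_Q_pow]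
  have h1 : ∀ i : Fin 3,
      pderiv (i, 0) (((k + 1 : ℕ) : MvPolynomial Var ℂ) * (Q ^ k * X (i, 0)))
        = ((k + 1 : ℕ) : MvPolynomial Var ℂ) *
            (((k : ℕ) : MvPolynomial Var ℂ) * (Q ^ (k - 1) * X (i, 1)) * X (i, 0) + Q ^ k) := by
    intro i
    rw [← pderiv_zero_Q_pow_mul, ← map_natCast (C : ℂ →+* MvPolynomial Var ℂ), pderiv_C_mul]
  simp_rw [h1]
  rw [← Finset.mul_sum, Finset.sum_add_distrib, Finset.sum_const, Finset.card_univ,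
    Fintype.card_fin]
  have hsum : ∑ i : Fin 3, ((k : ℕ) : MvPolynomial Var ℂ) * (Q ^ (k - 1) * X (i, 1)) * X (i, 0)
      = ((k : ℕ) : MvPolynomial Var ℂ) * Q ^ (k - 1) * Q := by
    rw [show Q = ∑ i : Fin 3, X (i, 0) * X (i, 1) from rfl, Finset.mul_sum]
    refine Finset.sum_congr rfl (fun i _ => ?_)
    ring
  rw [hsum]
  rcases k with _ | k
  · simp
  · rw [Nat.add_sub_cancel, pow_succ]
    push_cast
    ring

/-- The Fock variables of one hyperbolic plane: `w₁ = X 0`, `w₂ = X 1`. -/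
abbrev Var2 := Fin 2

/-- **`∂²/∂w₁∂w₂ (w₁^{α+1} w₂^{β+1}) = (α+1)(β+1) w₁^α w₂^β`** — the lowering operator of
(N4.3.P2-ter) on the `β′`-isotypic monomials, non-zero off the lowest vector. -/
theorem pderiv_pderiv_monomial (α β : ℕ) :
    pderiv (0 : Var2) (pderiv (1 : Var2) (X 0 ^ (α + 1) * X 1 ^ (β + 1) : MvPolynomial Var2 ℂ))
      = (((α + 1) * (β + 1) : ℕ) : MvPolynomial Var2 ℂ) * (X 0 ^ α * X 1 ^ β) := by
  have h1 : pderiv (1 : Var2) (X 0 ^ (α + 1) * X 1 ^ (β + 1) : MvPolynomial Var2 ℂ)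
      = ((β + 1 : ℕ) : MvPolynomial Var2 ℂ) * (X 0 ^ (α + 1) * X 1 ^ β) := by
    rw [Derivation.leibniz, Derivation.leibniz_pow, Derivation.leibniz_pow, pderiv_X, pderiv_X]
    simp [nsmul_eq_mul]
    ring
  rw [h1, ← map_natCast (C : ℂ →+* MvPolynomial Var2 ℂ), pderiv_C_mul, Derivation.leibniz,
    Derivation.leibniz_pow, Derivation.leibniz_pow, pderiv_X, pderiv_X]
  simp [nsmul_eq_mul]
  ring

/-- **The K-type matching of (N4.3.P2-ter).** If
`(M + 1)/2 + max(0, −c) = (m + 3)/2` and `(M − 1)/2 − max(0, c) = (m − 3)/2`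
then `c = 2, M = m + 2` or `c = −2, M = m − 2` (i.e. `1 + |c| = 3`, `M = m + c`). -/
theorem ktype_match (M m c : ℚ)
    (h1 : (M + 1) / 2 + max 0 (-c) = (m + 3) / 2)
    (h2 : (M - 1) / 2 - max 0 c = (m - 3) / 2) :
    (c = 2 ∧ M = m + 2) ∨ (c = -2 ∧ M = m - 2) := by
  rcases le_total 0 c with hc | hc
  · rw [max_eq_right hc] at h2
    rw [max_eq_left (by linarith)] at h1
    left
    constructor <;> linarith
  · rw [max_eq_left hc] at h2
    rw [max_eq_right (by linarith)] at h1
    right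
    constructor <;> linarith

/-- The conclusion of `ktype_match` in p5's form: `1 + |c| = 3` and `M = m + c`. -/
theorem ktype_match' (M m c : ℚ)
    (h1 : (M + 1) / 2 + max 0 (-c) = (m + 3) / 2)
    (h2 : (M - 1) / 2 - max 0 c = (m - 3) / 2) :
    1 + |c| = 3 ∧ M = m + c := by
  rcases ktype_match M m c h1 h2 with ⟨hc, hM⟩ | ⟨hc, hM⟩
  · subst hc; refine ⟨by norm_num, by linarith⟩
  · subst hc; refine ⟨by norm_num, by linarith⟩

/-- **A lowest-weight ladder is never a highest-weight ladder.** For every `m`: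
`{((m+3)/2 + k, (m−3)/2 − k) : k ∈ ℕ} ≠ {(−(m+3)/2 − k, −(m−3)/2 + k) : k ∈ ℕ}`
(the K-types of `π₀,τ′_j` versus those of its contragredient). -/
theorem lowest_ladder_ne_highest_ladder (m : ℚ) :
    Set.range (fun k : ℕ => ((m + 3) / 2 + k, (m - 3) / 2 - k))
      ≠ Set.range (fun k : ℕ => (-((m + 3) / 2) - k, -((m - 3) / 2) + k)) := by
  intro h
  have h0 : ((m + 3) / 2 + (0 : ℕ), (m - 3) / 2 - (0 : ℕ))
      ∈ Set.range (fun k : ℕ => (-((m + 3) / 2) - k, -((m - 3) / 2) + k)) := by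
    rw [← h]
    exact ⟨0, rfl⟩
  obtain ⟨k, hk⟩ := h0
  rw [Prod.ext_iff] at hk
  obtain ⟨hk1, hk2⟩ := hk
  simp only [Nat.cast_zero, add_zero, sub_zero] at hk1 hk2
  have hk0 : (0 : ℚ) ≤ k := Nat.cast_nonneg k
  linarith

end Summit.Ventures.HodgeRepro2.T5FockInvariants
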